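import Summits.ResolutionOfSingularities.ResolutionOfSingularities.Theorems.HilbertSamuelEliminationSigmaMaxModificationsCorridor3WLadderIsoInsepE2NearCubic
import HarnessLib

/-!
# [OURS · L1 W4.2] E2 chart calculus, brick 18a: RESIDUE FIELDS IN A CHART — at a `κ`-RATIONAL point `𝔭` of the reduction
# `π : B ↠ κ[T]` every element of `B_𝔔` (`𝔔 = π⁻¹𝔭`) is congruent to a constant from `R` modulo `𝔪_{B_𝔔}`
# (crux chain w42, cell k2 `T3insep` = `stub_isoInsepTower`; `--supports stmt-ResolutionOfSingularities-19249`)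

OURS (cell res-hironaka, slot W4.2, seat res-D-pv-042; OWN OBJECT TUO 2026-08-27 18:19Z, (N4) = the RC row of the NJ/RC dictionary);
NOT a statement of [Hironaka2017] nor of [CossartJannsenSaito2020] / [CossartPiltant2008]. AI-drafted, weaker than expert review.
PROOF file, def-free, fact-free.

* `aeval_C_eq_C_eval` — `f(C(p₁), …, C(pₙ)) = C(f(p))`.
* `sub_C_eval_mem_of_forall_X_sub_C_mem` — if `T_k − p_k ∈ 𝔭` for all `k` then `f − f(p) ∈ 𝔭` (Taylor at a rational point).
* `exists_sub_algebraMap_mem_of_rationalPoint` — for an `R`-algebra `B` (`R` local, residue field `κ`) with a map `π : B → κ[T_k]` sending `R` to the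
  constants `C ∘ residue`, a prime `𝔔 = π⁻¹(𝔭)` and a `κ`-point `p` with `T_k − p_k ∈ 𝔭`: every `b ∈ B` is `≡ r (mod 𝔔)` for some `r ∈ R`.
* `exists_sub_algebraMap_mem_maximalIdeal_of_rationalPoint` — hence every `z ∈ B_𝔔` is `≡ r/1 (mod 𝔪_{B_𝔔})` for some `r ∈ R`: **the residue field of
  `B_𝔔` is the image of `R`** (`κ(𝔔) = κ(R)`). Applied (brick 18b) to `B = R[𝔪/c_j]` at the next point of an E2 step with `deg P = 1`
  (brick 16), this is the RC row `IsoInsepE2SuccRational₂`: `κ(x_n) → κ(x_{n+1})` is onto.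

## References

* V. Cossart, U. Jannsen, S. Saito, LNM 2270 (2020): Def. 2.26, Thm. 3.10 (pointer: residue fields of near points). [CossartJannsenSaito2020]
-/

noncomputable section

set_option linter.dupNamespace false

open IsLocalRing MvPolynomial

universe u v w

namespace Summit.ResolutionOfSingularities.ResolutionOfSingularities.Cruxes.SigmaMaxModifications.IdeasL1C6.E2Chart

/-- `f(C ∘ p) = C(f(p))`: substituting constants gives the constant `f(p)`. [folklore] -/
theorem aeval_C_eq_C_eval {κ : Type u} [CommRing κ] {ι : Type v} (p : ι → κ) (f : MvPolynomial ι κ) :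
    MvPolynomial.aeval (fun k : ι => (C (p k) : MvPolynomial ι κ)) f = C (MvPolynomial.eval p f) := by
  have h : (MvPolynomial.aeval fun k : ι => (C (p k) : MvPolynomial ι κ)) =
      (Algebra.ofId κ (MvPolynomial ι κ)).comp (MvPolynomial.aeval p) :=
    MvPolynomial.algHom_ext fun k => by simp [Algebra.ofId_apply, MvPolynomial.algebraMap_eq]
  rw [h, AlgHom.comp_apply, Algebra.ofId_apply, MvPolynomial.algebraMap_eq]
  rfl

/-- **Taylor at a rational point**: if `T_k − p_k ∈ 𝔭` for every variable then `f − f(p) ∈ 𝔭` for every polynomial `f`. [folklore] -/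
theorem sub_C_eval_mem_of_forall_X_sub_C_mem {κ : Type u} [CommRing κ] {ι : Type v} (𝔭 : Ideal (MvPolynomial ι κ)) (p : ι → κ)
    (hp : ∀ k : ι, (X k : MvPolynomial ι κ) - C (p k) ∈ 𝔭) (f : MvPolynomial ι κ) :
    f - C (MvPolynomial.eval p f) ∈ 𝔭 := by
  have h := aeval_sub_aeval_mem_of_forall_sub_mem 𝔭 (a := fun k : ι => (X k : MvPolynomial ι κ))
    (b := fun k : ι => (C (p k) : MvPolynomial ι κ)) hp f
  rwa [MvPolynomial.aeval_X_left_apply, aeval_C_eq_C_eval] at h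

/-- **EVERY ELEMENT OF `B` IS A CONSTANT MODULO `𝔔` at a `κ`-rational point.** Let `R` be local with residue field `κ`, `B` an
`R`-algebra, `π : B → κ[T_k]` a ring map with `π(r) = C(r̄)` for `r ∈ R`, `𝔭` an ideal of `κ[T_k]` with `π⁻¹(𝔭) = 𝔔`, and `p` a
`κ`-point with `T_k − p_k ∈ 𝔭` for all `k`. Then for every `b ∈ B` there is `r ∈ R` with `b − r ∈ 𝔔`. [OURS · L1 W4.2 · k2 · E2 chart
calculus, brick 18a] [folklore] -/
theorem exists_sub_algebraMap_mem_of_rationalPoint {R : Type u} [CommRing R] [IsLocalRing R] {B : Type v} [CommRing B] [Algebra R B]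
    {ι : Type w}
    (π : B →+* MvPolynomial ι (ResidueField R)) (hπalg : ∀ a : R, π (algebraMap R B a) = C (residue R a))
    {𝔔 : Ideal B} {𝔭 : Ideal (MvPolynomial ι (ResidueField R))} (hcomap : 𝔭.comap π = 𝔔) (p : ι → ResidueField R)
    (hp : ∀ k : ι, (X k : MvPolynomial ι (ResidueField R)) - C (p k) ∈ 𝔭) (b : B) :
    ∃ r : R, b - algebraMap R B r ∈ 𝔔 := by
  obtain ⟨r, hr⟩ := Ideal.Quotient.mk_surjective (I := maximalIdeal R) (MvPolynomial.eval p (π b))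
  refine ⟨r, ?_⟩
  rw [← hcomap, Ideal.mem_comap, map_sub, hπalg]
  have h := sub_C_eval_mem_of_forall_X_sub_C_mem 𝔭 p hp (π b)
  have hres : residue R r = MvPolynomial.eval p (π b) := hr
  rwa [hres]

/-- **THE RESIDUE FIELD OF `B_𝔔` IS THE IMAGE OF `R`** at a `κ`-rational point: in the situation of `exists_sub_algebraMap_mem_of_rationalPoint` with
`𝔔` prime, every `z ∈ B_𝔔` satisfies `z − r/1 ∈ 𝔪_{B_𝔔}` for some `r ∈ R` (write `z = b/s`, `b ≡ r_b`, `s ≡ r_s (mod 𝔔)` with `r_s` a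
unit of `R` since `s ∉ 𝔔`, and take `r = r_b r_s⁻¹`). [OURS · L1 W4.2 · k2 · E2 chart calculus, brick 18a] [folklore] -/
theorem exists_sub_algebraMap_mem_maximalIdeal_of_rationalPoint {R : Type u} [CommRing R] [IsLocalRing R] {B : Type v} [CommRing B] [Algebra R B]
    {ι : Type w} (π : B →+* MvPolynomial ι (ResidueField R)) (hπalg : ∀ a : R, π (algebraMap R B a) = C (residue R a))
    (𝔔 : Ideal B) [𝔔.IsPrime] {𝔭 : Ideal (MvPolynomial ι (ResidueField R))} (hcomap : 𝔭.comap π = 𝔔) (p : ι → ResidueField R)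
    (hp : ∀ k : ι, (X k : MvPolynomial ι (ResidueField R)) - C (p k) ∈ 𝔭) (z : Localization.AtPrime 𝔔) :
    ∃ r : R, z - algebraMap B (Localization.AtPrime 𝔔) (algebraMap R B r) ∈ maximalIdeal (Localization.AtPrime 𝔔) := by
  obtain ⟨⟨b, s⟩, rfl⟩ := IsLocalization.mk'_surjective 𝔔.primeCompl z
  obtain ⟨rb, hb⟩ := exists_sub_algebraMap_mem_of_rationalPoint π hπalg hcomap p hp b
  obtain ⟨rs, hs⟩ := exists_sub_algebraMap_mem_of_rationalPoint π hπalg hcomap p hp (s : B)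
  -- `r_s` is a unit of `R`
  have hrs : IsUnit rs := by
    by_contra hu
    have hrs𝔪 : rs ∈ maximalIdeal R := hu
    have h0 : residue R rs = 0 := (residue_eq_zero_iff rs).mpr hrs𝔪
    have hs𝔔 : algebraMap R B rs ∈ 𝔔 := by
      rw [← hcomap, Ideal.mem_comap, hπalg, h0, map_zero]
      exact zero_mem _
    have hs' : (s : B) ∈ 𝔔 := by
      have := 𝔔.add_mem hs hs𝔔
      rwa [sub_add_cancel] at this
    exact s.2 hs'
  obtain ⟨u, hu⟩ := hrs
  refine ⟨rb * ↑u⁻¹, ?_⟩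
  -- numerator `b − r·s ∈ 𝔔`
  have hkey : algebraMap R B (rb * ↑u⁻¹) * algebraMap R B rs = algebraMap R B rb := by
    rw [← map_mul, mul_assoc, ← hu, Units.inv_mul, mul_one]
  have hnum : b - algebraMap R B (rb * ↑u⁻¹) * (s : B) ∈ 𝔔 := by
    have e1 : b - algebraMap R B (rb * ↑u⁻¹) * (s : B) =
        (b - algebraMap R B rb) - algebraMap R B (rb * ↑u⁻¹) * ((s : B) - algebraMap R B rs) := by
      linear_combination (-1 : B) * hkey
    rw [e1]
    exact 𝔔.sub_mem hb (𝔔.mul_mem_left _ hs)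
  have hunit : IsUnit (algebraMap B (Localization.AtPrime 𝔔) (s : B)) := IsLocalization.map_units (Localization.AtPrime 𝔔) s
  have ht : (IsLocalization.mk' (Localization.AtPrime 𝔔) b s -
        algebraMap B (Localization.AtPrime 𝔔) (algebraMap R B (rb * ↑u⁻¹))) * algebraMap B (Localization.AtPrime 𝔔) (s : B) =
      algebraMap B (Localization.AtPrime 𝔔) (b - algebraMap R B (rb * ↑u⁻¹) * (s : B)) := by
    rw [sub_mul, IsLocalization.mk'_spec, map_sub, map_mul (algebraMap B (Localization.AtPrime 𝔔)) _ (s : B)]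
  rw [← Ideal.mul_unit_mem_iff_mem _ hunit, ht]
  exact (IsLocalization.AtPrime.to_map_mem_maximal_iff (Localization.AtPrime 𝔔) 𝔔 _).mpr hnum

end Summit.ResolutionOfSingularities.ResolutionOfSingularities.Cruxes.SigmaMaxModifications.IdeasL1C6.E2Chart

end
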